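import Literature.NumberTheory.EllipticCurves.CanonicalPAdicHeightHolds
import Literature.NumberTheory.EllipticCurves.CanonicalPAdicHeightThetaFormalProofs
import Literature.NumberTheory.EllipticCurves.CanonicalPAdicHeightSigmaThetaProofs
import Literature.NumberTheory.EllipticCurves.PadicSigmaUniquenessOrdinaryProofs
import HarnessLib

/-!
# The Mazur–Tate sigma function and the canonical `p`-adic height at an ODD prime (`p = 3` included)

Topic `NumberTheory/EllipticCurves` (trunk T-NT-EC). ONE named fact and its proved consequences.
HONEST FRAMING (BSD rank-≤1 residual cell `b2b-bsdres`, unit `b2b-bsdres-x1b`, prover B, gen 4 —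
independent patchwork, no preprint input anywhere): the cell deletes the COMBINATION-SHAPED residual
classes of the rank-`≤ 1` BSD formula STRICTLY from published theorems and TYPES the remainder; this is
not "finishing BSD". This file supplies the 3-ADIC VOCABULARY that the rank-one `p`-adic engine of the
cell (`Wuthrich2014/RankOneEngineProofs`, `RankOneConverseProofs`, `Rank1Residual/X1RankOne`: Wuthrich
Thm. 16 + Perrin-Riou–Schneider + Perrin-Riou 1987) lacked: all canonical-height facts of the tree carry
`5 ≤ p`, while 396 of the 434 rank-one census pairs of class X1 (conductor `< 10⁴`) sit at `p = 3`.

## Why `5 ≤ p` in the tree, and what is genuinely missing at `p = 3`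

The tree's canonical cyclotomic `p`-adic height is the sigma-formula height
(`WeierstrassCurve.canonicalPAdicHeight`, `PAdicHeightData.IsCanonical`, `CanonicalPAdicHeight.lean`),
built on THE Mazur–Tate pair `(σ_p, c)` of `W ⊗ ℚ_p` (`WeierstrassCurve.padicSigma`, `PadicSigma.lean`:
`σ = t + ⋯ ∈ tℤ_p⟦t⟧` odd, `c ∈ ℤ_p`, `x(t) + c = -(d/ω)(σ⁻¹ dσ/ω)`). Everything downstream of the
pair is proved in the tree WITHOUT `p ≥ 5`:
* uniqueness of the pair at any odd prime of good ordinary reduction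
  (`IsMazurTateSigmaPair.unique_of_unbounded_formalLog` with
  `norm_coeff_formalOmega_eq_one_of_good_ordinary`, hypothesis `p ≠ 2` — assembled below as
  `IsMazurTateSigmaPair.unique_of_good_ordinary_odd`);
* the formal theta relation for any pair (`thetaLHS_eq_thetaRHS`, Blakestad–Grant 2023 Prop. 14 — no
  hypothesis on `p`);
* the canonical height datum from the theta relation (`exists_isCanonical_of_thetaLHS_eq`,
  `existsUnique_isCanonical_of_thetaLHS_eq`, hypothesis `p ≠ 2`).
What carries `5 ≤ p` ESSENTIALLY is only the tree's proof of EXISTENCE of the pair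
(`mazur_tate_sigma_existsUnique_holds`, `PadicSigmaExistenceProofs.lean`: Blakestad–Grant's universal
`p`-adic sigma function over the universal ordinary ring, set up for `p ≥ 5`). The existence of the
pair at `p = 3` is a published theorem (below); it is recorded here as the named fact
`mazur_tate_sigma_exists_odd`, stated — as printed — for every odd prime of good ordinary reduction;
`mazur_tate_sigma_exists_odd_iff_three` shows that, given the tree's theorem for `p ≥ 5`, its only new
content is the single prime `p = 3`.

## Sources (read for this file)

* J. S. Balakrishnan, *On 3-adic heights on elliptic curves*, J. Number Theory 161 (2016) 119–134
  (held: `paper:doi-10-1016-j-jnt-2015-07-003`), §2 (p. 2 of the held text): "Let `p` be an odd prime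
  of good ordinary reduction for `E`. … The cyclotomic `p`-adic height of `P`, `h_p(P)` can be computed
  by taking `h_p(P) = (1/p) log_p(σ_p(P)/d(P))`, where `σ_p` is the `p`-adic sigma function [MT91] …
  The height function `h_p` extends uniquely to a function on the full Mordell-Weil group `E(ℚ)` that
  satisfies `h_p(nQ) = n² h_p(Q)` … we obtain a pairing on `E(ℚ)`" (display (2.2)); p. 3, eq. (2.3):
  "The `p`-adic sigma function `σ_p` is the unique odd function `σ_p(t) = t + s₂t² + s₃t³ + ⋯ ∈ tℤ_p⟦t⟧`
  satisfying the differential equation `x(t) + c = -(d/ω)((1/σ)(dσ/ω))`, where … `c` is the constant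
  `(a₁² + 4a₂ - E₂(E,ω))/12`" — the paper's subject is exactly the prime `p = 3`
  (abstract: "we extend their algorithm to the case of `p = 3`"). (`Balakrishnan2016`)
* B. Mazur, W. Stein, J. Tate, *Computation of `p`-adic heights and log convergence*, Doc. Math. Extra
  Vol. Coates (2006), §1 ("Let `p` be an odd prime number", p. 2 of the held text
  `paper:anon2006-computation-p-adic-heights-log-convergence`), eq. (1.1) and Thm. 1.3 ("There is
  exactly one odd function `σ(t) = t + ⋯ ∈ tℤ_p⟦t⟧` and constant `c ∈ ℤ_p` that together satisfy the
  differential equation (1.3)", "proved in [MT91]"); the running restriction `p ≥ 5` of MST §1 is for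
  the computation of `E₂` by Kedlaya's algorithm (Balakrishnan 2016, §1–§2). (`MazurSteinTate2006`)
* B. Mazur, J. Tate, *The `p`-adic sigma function*, Duke Math. J. 62 (1991) 663–688, Thm. 3.1 (the
  source of MST Thm. 1.3; not held — cited through MST 2006 and Balakrishnan 2016). (`MazurTate1991`)

## What is here

* `mazur_tate_sigma_exists_odd` (NAMED FACT, nothing asserted): for `W/ℚ` globally minimal and `p ≠ 2`
  of good ordinary reduction, SOME Mazur–Tate pair of `W ⊗ ℚ_p` exists (the existence half of MST
  Thm. 1.3 = MT91 Thm. 3.1, as printed for odd `p` by Balakrishnan 2016, eq. (2.3));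
* PROVED: `IsMazurTateSigmaPair.unique_of_good_ordinary_odd` (uniqueness at odd `p`),
  `mazur_tate_sigma_existsUnique_of_odd` (`∃!` pair), `thetaLHS_padicSigma_eq_of_odd` (theta relation
  for `σ_p`), `exists_isCanonical_of_odd` / `existsUnique_isCanonical_of_odd` (THE canonical `p`-adic
  height datum exists, uniquely, at every odd good ordinary `p` — the hypothesis shape consumed by
  `Schneider1985_order_charGenerator_odd` and `perrinRiou_rankOne_leadingTerms_odd`),
  `mazur_tate_sigma_exists_odd_of_five_le` (the `p ≥ 5` instances are the tree theorem) and
  `mazur_tate_sigma_exists_odd_iff_three` (the fact is EQUIVALENT to its `p = 3` instance).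

## Design notes

* The fact is the EXISTENCE clause only; "exactly one" is then a theorem (uniqueness needs only
  `p ≠ 2` in the tree). It is stated for all odd `p` because that is how the sources print it; the
  `_iff_three` lemma makes the residual trust explicit.
* No new definition: `IsMazurTateSigmaPair`, `padicSigma`, `IsCanonical` are the tree's (so at `p = 3`
  `IsCanonical` is Balakrishnan's `h_3 = (1/3) log_3(σ_3/d)` times `-2p`, exactly as at `p ≥ 5`:
  `canonicalPAdicHeight = log_p(den x) - 2 log_p σ_p(-x/y)`; the sigma disc `‖t‖ < p^{-1/(p-1)}`
  contains `3ℤ_3` at `p = 3`).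
* Not here: the analytic facts at odd `p` (Perrin-Riou–Schneider, Perrin-Riou 1987) — separate files
  `IwasawaLeadingTermOddPrime.lean`, `PAdicGrossZagierOddPrime.lean`; `p = 2` (MST treat it separately;
  the tree's oddness/uniqueness lemmas use `p ≠ 2`).
-/

noncomputable section

open scoped Classical
open PowerSeries WeierstrassCurve

namespace Literature.NumberTheory.EllipticCurves

/-! ### The named fact -/

/-- **Existence of the Mazur–Tate `p`-adic sigma function at an odd prime of good ordinary reduction**
(B. Mazur, J. Tate, *The `p`-adic sigma function*, Duke Math. J. 62 (1991), Thm. 3.1; B. Mazur,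
W. Stein, J. Tate, Doc. Math. Extra Vol. Coates (2006), Thm. 1.3: "There is exactly one odd function
`σ(t) = t + ⋯ ∈ tℤ_p⟦t⟧` and constant `c ∈ ℤ_p` that together satisfy the differential equation
`x(t) + c = -(d/ω)((1/σ)(dσ/ω))`", for "`p` an odd prime number" (§1, p. 2); J. S. Balakrishnan,
J. Number Theory 161 (2016), §2 eq. (2.3), verbatim for "`p` an odd prime of good ordinary reduction":
"The `p`-adic sigma function `σ_p` is the unique odd function `σ_p(t) = t + s₂t² + s₃t³ + ⋯ ∈ tℤ_p⟦t⟧`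
satisfying the differential equation `x(t) + c = -(d/ω)((1/σ)(dσ/ω))`", the case `p = 3` being that
paper's subject). Statement (EXISTENCE clause only; uniqueness is the theorem
`IsMazurTateSigmaPair.unique_of_good_ordinary_odd`): for `E/ℚ` with globally minimal model `W` and a
prime `p ≠ 2` of good ordinary reduction (`p ∤ a_p`), some Mazur–Tate pair `(σ, c)` of `W ⊗ ℚ_p` exists
(`IsMazurTateSigmaPair`: `σ(0) = 0`, `σ'(0) = 1`, coefficients and `c` in `ℤ_p`, `σ` odd, sigma
equation). For `p ≥ 5` this is the tree THEOREM `mazur_tate_sigma_existsUnique_holds` (Blakestad–Grant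
2023); the fact's only new content is `p = 3` (`mazur_tate_sigma_exists_odd_iff_three`). Named fact
(D-0014): nothing is asserted; users take `(h : mazur_tate_sigma_exists_odd)`.
[cite: MazurSteinTate2006, Thm. 1.3 (existence) and §1 p. 2 ("p an odd prime")]
[cite: Balakrishnan2016, §2 eq. (2.3) and display before (2.2)]
[cite: MazurTate1991, Thm. 3.1] -/
def mazur_tate_sigma_exists_odd : Prop :=
  ∀ (W : WeierstrassCurve ℚ) [W.IsElliptic] [W.IsGloballyMinimal] (p : ℕ) [Fact p.Prime],
    p ≠ 2 → W.HasGoodReductionAtPrime p → ¬ (p : ℤ) ∣ W.frobeniusTrace p →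
      ∃ σ : ℚ_[p]⟦X⟧, ∃ c : ℚ_[p], (W.baseChange ℚ_[p]).IsMazurTateSigmaPair σ c

/-! ### Uniqueness at odd `p` (proved) -/

/-- **Uniqueness of the Mazur–Tate pair at an odd prime of good ordinary reduction** (the "exactly
one" of MST 2006 Thm. 1.3 / MT91 Thm. 3.1, uniqueness half), PROVED for every `p ≠ 2`: the formal
logarithm of `W ⊗ ℚ_p` has unbounded coefficients because `c_{p^{k+1}-1} ∈ ℤ_pˣ` at a good ordinary odd
prime (`norm_coeff_formalOmega_eq_one_of_good_ordinary`, Atkin–Swinnerton-Dyer / Hasse invariant), and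
two pairs then coincide (`IsMazurTateSigmaPair.unique_of_unbounded_formalLog`). The tree's
`IsMazurTateSigmaPair.unique_of_good_ordinary` is the same with the idle hypothesis `5 ≤ p`.
[cite: MazurSteinTate2006, Thm. 1.3] [cite: Balakrishnan2016, §2 eq. (2.3)] -/
theorem IsMazurTateSigmaPair.unique_of_good_ordinary_odd (W : WeierstrassCurve ℚ)
    [W.IsGloballyMinimal] (p : ℕ) [Fact p.Prime] (hp2 : p ≠ 2)
    (hgood : W.HasGoodReductionAtPrime p) (hord : ¬ (p : ℤ) ∣ W.frobeniusTrace p)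
    {σ₁ σ₂ : ℚ_[p]⟦X⟧} {c₁ c₂ : ℚ_[p]}
    (h₁ : (W.baseChange ℚ_[p]).IsMazurTateSigmaPair σ₁ c₁)
    (h₂ : (W.baseChange ℚ_[p]).IsMazurTateSigmaPair σ₂ c₂) : σ₁ = σ₂ ∧ c₁ = c₂ :=
  h₁.unique_of_unbounded_formalLog
    ((W.baseChange ℚ_[p]).unbounded_formalLog_of_norm_coeff_formalOmega_eq_one
      fun k => norm_coeff_formalOmega_eq_one_of_good_ordinary W p hp2 hgood hord k) h₂

/-- **"Exactly one" Mazur–Tate pair at an odd good ordinary prime**, from the existence fact and the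
proved uniqueness. [cite: MazurSteinTate2006, Thm. 1.3] [cite: Balakrishnan2016, §2 eq. (2.3)] -/
theorem mazur_tate_sigma_existsUnique_of_odd (hex : mazur_tate_sigma_exists_odd)
    (W : WeierstrassCurve ℚ) [W.IsElliptic] [W.IsGloballyMinimal] (p : ℕ) [Fact p.Prime]
    (hp2 : p ≠ 2) (hgood : W.HasGoodReductionAtPrime p) (hord : ¬ (p : ℤ) ∣ W.frobeniusTrace p) :
    ∃! σc : ℚ_[p]⟦X⟧ × ℚ_[p], (W.baseChange ℚ_[p]).IsMazurTateSigmaPair σc.1 σc.2 :=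
  (W.baseChange ℚ_[p]).existsUnique_isMazurTateSigmaPair_of_exists
    ((W.baseChange ℚ_[p]).unbounded_formalLog_of_norm_coeff_formalOmega_eq_one
      fun k => norm_coeff_formalOmega_eq_one_of_good_ordinary W p hp2 hgood hord k)
    (hex W p hp2 hgood hord)

/-- At an odd good ordinary prime the tree's chosen pair `(padicSigma, padicSigmaConst)` of `W ⊗ ℚ_p`
IS a Mazur–Tate pair (given the existence fact) — so `σ_p := padicSigma (W ⊗ ℚ_p)` is THE `p`-adic
sigma function of Mazur–Tate, by uniqueness. [cite: MazurSteinTate2006, Thm. 1.3] -/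
theorem isMazurTateSigmaPair_padicSigma_of_odd (hex : mazur_tate_sigma_exists_odd)
    (W : WeierstrassCurve ℚ) [W.IsElliptic] [W.IsGloballyMinimal] (p : ℕ) [Fact p.Prime]
    (hp2 : p ≠ 2) (hgood : W.HasGoodReductionAtPrime p) (hord : ¬ (p : ℤ) ∣ W.frobeniusTrace p) :
    (W.baseChange ℚ_[p]).IsMazurTateSigmaPair (W.baseChange ℚ_[p]).padicSigma
      (W.baseChange ℚ_[p]).padicSigmaConst :=
  (W.baseChange ℚ_[p]).isMazurTateSigmaPair_padicSigma (hex W p hp2 hgood hord)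

/-! ### The canonical `p`-adic height at odd `p` (proved from the fact) -/

/-- **The theta relation for `σ_p` at an odd good ordinary prime**:
`σ(u +_F v)σ(u -_F v)u²v² = (u²X(v) - v²X(u))σ(u)²σ(v)²` in `ℚ_p⟦u,v⟧` for `σ = padicSigma (W ⊗ ℚ_p)`
(Blakestad–Grant 2023 Prop. 14 as the tree theorem `thetaLHS_eq_thetaRHS`, which has no hypothesis on
`p`; the fact supplies that `padicSigma` is a pair). [cite: BlakestadGrant2023, Prop. 14]
[cite: MazurSteinTate2006, Thm. 1.3] -/
theorem thetaLHS_padicSigma_eq_of_odd (hex : mazur_tate_sigma_exists_odd)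
    (W : WeierstrassCurve ℚ) [W.IsElliptic] [W.IsGloballyMinimal] (p : ℕ) [Fact p.Prime]
    (hp2 : p ≠ 2) (hgood : W.HasGoodReductionAtPrime p) (hord : ¬ (p : ℤ) ∣ W.frobeniusTrace p) :
    (W.baseChange ℚ_[p]).thetaLHS (W.baseChange ℚ_[p]).padicSigma =
      (W.baseChange ℚ_[p]).thetaRHS (W.baseChange ℚ_[p]).padicSigma := by
  have hpair := isMazurTateSigmaPair_padicSigma_of_odd hex W p hp2 hgood hord
  exact thetaLHS_eq_thetaRHS hpair.constantCoeff_eq hpair.coeff_one_eq hpair.odd hpair.ode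

/-- **Existence of THE canonical cyclotomic `p`-adic height at an odd prime of good ordinary
reduction** (`p = 3` included): a datum `D : PAdicHeightData W p` with `D.IsCanonical`, i.e. whose
quadratic form on admissible points is the sigma-formula height
`ĥ_p(P) = log_p(den x(P)) - 2 log_p σ_p(-x/y) = -2p · h_p(P)`, `h_p(P) = (1/p) log_p(σ_p(P)/d(P))`
(Balakrishnan 2016 §2, display before (2.2), for odd `p`; MST 2006 eq. (1.1)). PROVED from the fact
`mazur_tate_sigma_exists_odd` by the tree's construction `exists_isCanonical_of_thetaLHS_eq` (which
asks only `p ≠ 2`). The tree's `exists_isCanonical_holds` is the case `p ≥ 5`.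
[cite: Balakrishnan2016, §2 (display before (2.2))] [cite: MazurSteinTate2006, §1 eq. (1.1)] -/
theorem exists_isCanonical_of_odd (hex : mazur_tate_sigma_exists_odd)
    (W : WeierstrassCurve ℚ) [W.IsElliptic] [W.IsGloballyMinimal] (p : ℕ) [Fact p.Prime]
    (hp2 : p ≠ 2) (hgood : W.HasGoodReductionAtPrime p) (hord : ¬ (p : ℤ) ∣ W.frobeniusTrace p) :
    ∃ D : PAdicHeightData W p, D.IsCanonical :=
  exists_isCanonical_of_thetaLHS_eq W p hp2 (thetaLHS_padicSigma_eq_of_odd hex W p hp2 hgood hord)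

/-- **Existence AND uniqueness of the canonical `p`-adic height datum at an odd good ordinary prime**
(admissible multiples exist: `exists_admissible_nsmul_holds`, any `p`). The tree's
`existsUnique_isCanonical_holds` is the case `p ≥ 5`. [cite: Balakrishnan2016, §2 (display before (2.2))]
[cite: MazurSteinTate2006, §1 eq. (1.1)] -/
theorem existsUnique_isCanonical_of_odd (hex : mazur_tate_sigma_exists_odd)
    (W : WeierstrassCurve ℚ) [W.IsElliptic] [W.IsGloballyMinimal] (p : ℕ) [Fact p.Prime]
    (hp2 : p ≠ 2) (hgood : W.HasGoodReductionAtPrime p) (hord : ¬ (p : ℤ) ∣ W.frobeniusTrace p) :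
    ∃! D : PAdicHeightData W p, D.IsCanonical :=
  existsUnique_isCanonical_of_thetaLHS_eq W p hp2 (thetaLHS_padicSigma_eq_of_odd hex W p hp2 hgood hord)

/-! ### What the fact adds to the tree: exactly the prime `3` -/

/-- The instances `p ≥ 5` of `mazur_tate_sigma_exists_odd` are the tree THEOREM
`mazur_tate_sigma_existsUnique_holds` (Blakestad–Grant 2023). [cite: MazurSteinTate2006, Thm. 1.3]
[cite: BlakestadGrant2023, Thm. 1] -/
theorem mazur_tate_sigma_exists_odd_of_five_le (W : WeierstrassCurve ℚ) [W.IsElliptic]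
    [W.IsGloballyMinimal] (p : ℕ) [Fact p.Prime] (hp : 5 ≤ p) (hgood : W.HasGoodReductionAtPrime p)
    (hord : ¬ (p : ℤ) ∣ W.frobeniusTrace p) :
    ∃ σ : ℚ_[p]⟦X⟧, ∃ c : ℚ_[p], (W.baseChange ℚ_[p]).IsMazurTateSigmaPair σ c := by
  obtain ⟨σc, hσc, -⟩ := mazur_tate_sigma_existsUnique_holds W p hp hgood hord
  exact ⟨σc.1, σc.2, hσc⟩

/-- **The residual trust is the single prime `p = 3`:** `mazur_tate_sigma_exists_odd` is EQUIVALENT to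
its instance at `p = 3` (an odd prime is `3` or `≥ 5`, and the latter case is the tree theorem).
[cite: Balakrishnan2016, §2 eq. (2.3)] [cite: MazurSteinTate2006, Thm. 1.3] -/
theorem mazur_tate_sigma_exists_odd_iff_three :
    mazur_tate_sigma_exists_odd ↔
      ∀ (W : WeierstrassCurve ℚ) [W.IsElliptic] [W.IsGloballyMinimal] [Fact (3 : ℕ).Prime],
        W.HasGoodReductionAtPrime 3 → ¬ ((3 : ℕ) : ℤ) ∣ W.frobeniusTrace 3 →
          ∃ σ : ℚ_[3]⟦X⟧, ∃ c : ℚ_[3], (W.baseChange ℚ_[3]).IsMazurTateSigmaPair σ c := by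
  constructor
  · intro h W _ _ _ hgood hord
    exact h W 3 (by decide) hgood hord
  · intro h3 W _ _ p _ hp2 hgood hord
    have hpP : p.Prime := Fact.out
    by_cases hp5 : 5 ≤ p
    · exact mazur_tate_sigma_exists_odd_of_five_le W p hp5 hgood hord
    · have hp3 : p = 3 := by
        have h2 := hpP.two_le
        interval_cases p
        · exact absurd rfl hp2
        · rfl
        · exact absurd hpP (by decide)
      subst hp3
      exact h3 W hgood hord

end Literature.NumberTheory.EllipticCurves

end
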